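import Summits.BirchSwinnertonDyer.BirchSwinnertonDyer.Theorems.SignedLowerHalvesSmallImageLowerHalfBothSignsRttD2SeqSemilocLayer
import Literature.NumberTheory.GaloisRepresentations.ContinuousCohomologyTorsion
import Literature.NumberTheory.EllipticCurves.IwasawaTowerLayers
import HarnessLib

/-!
# Route `SignedLowerHalves`, crux L `SmallImageLowerHalfBothSigns` (stmt-BirchSwinnertonDyer-23599), line `rtt_w3` v24 — stub S3β (`stub_junctionPT_ns`), brick T1-b₁:
# THE FOUR TRANSITIONS OF THE SEMILOCAL LAYER GROUPS `Lloc_w(n,k) = H^i(Γ_{K_w}, Maps(Γ_K ⧸ U_n, X_k))` AND THEIR ALGEBRA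
# (corestriction = fibre sum, reduction / `𝒪`-scalars = coefficient maps, conjugation = right translation; `𝒪`-module structure, `p^k`-torsion, unipotence of `R_γ`)

WIDTH seat `bsd-line-slh-p3-w3` g25 under LEAD `cruxlead-stmt-BirchSwinnertonDyer-23599` g13 (cell `bsd-ssimc`); helper `--supports stmt-BirchSwinnertonDyer-23599`
(design memo `Lines/rtt_w3-DESIGN-S3beta-w3-g25.md`, §2 T1-b). DEFINITIONS WITH BODIES + THEOREMS; no named fact, no instance, no `sorry`. Sequel of T1-a (`…RttD2SeqSemilocLayer`:
`semilocCoh`, `semilocNK`). This file is the semilocal twin of honda's `…CarriersOLevels` for the level groups `H^i(G_P(K_n), X_k)`: every transition is `H^i(res_w, φ)` for a morphism `φ`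
of the coinduced `Γ_K`-modules, so all identities are POINTWISE identities of maps of `Maps(Γ_K ⧸ U_n, X_k)` pushed through the functor `H^i` (`semilocH_comp/_add/_eq_self`).
HONEST FRAMING: bookkeeping for the limit datum (T1-b₂); nothing about S3β, E2, crux L or BSD is proved; all remain OPEN and are proved for NO curve.

* §1 `layerQuotFintype` (index `pⁿ`), the functor helper `semilocH φ i := H^i(res_w, φ)` and its calculus.
* §2 the transitions `semilocCores` (`coindFinSum`), `semilocCoeff`/`semilocRed`/`semilocScalar` (`coindFinMap`), `semilocConj γ` (`rTransHom (γ U_n)`); `semilocNK` compatibilities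
  restated in this currency (`semilocNK_cores/_red/_scalar/_conj`).
* §3 algebra: `semilocScalar` is a ring action (`semilocScalarRingHom`, `semilocModuleO`), `semilocConj` is a group action trivial on `U_n` with `(R_γ)^{pⁿ} = 1`, `p^k`-torsion,
  and the commutations cores/red/scalar ↔ conj/scalar.
References: [NeukirchSchmidtWingberg2008] I §5–§6; [SerreLocalFields1979] VII §5–§6; [Kato2004Asterisque] §8.2; [Lang1990] Ch. 5 §1; [JohnsonLeungKings2011] §4.1–4.2.
-/

set_option autoImplicit false
set_option linter.dupNamespace false -- D-0017: single-problem summit, the namespace repeats the problem name by design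
noncomputable section

open scoped Classical
open NumberField IsDedekindDomain Field CategoryTheory Function

namespace Summit.BirchSwinnertonDyer.BirchSwinnertonDyer.Theorems.SmallImageRttD2Seq

open Literature.NumberTheory.EllipticCurves Literature.NumberTheory.GaloisRepresentations
  Literature.NumberTheory.ComplexMultiplication.EllipticUnits.JohnsonLeungKings2011
  Summit.BirchSwinnertonDyer.BirchSwinnertonDyer.Theorems.SmallImageRttD2J1

section LevelOps

variable {K : Type} [Field K] [NumberField K] {p : ℕ} [Fact p.Prime] (S : Set (PadicAlgCl p)) (κ : ZpExtension K p)
  (θ' : absoluteGaloisGroup K →ₜ* (padicCoeffIntegers S)ˣ) (P : Set (HeightOneSpectrum (𝓞 K))) (w : HeightOneSpectrum (𝓞 K))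

/-! ## §1. Finiteness of the layers and the functor helper -/

/-- A `Fintype` structure on `Γ_K ⧸ U_n` (index `pⁿ`; any two are equal), feeding the `Fintype` binders of `coindFinSum`. [cite: Washington1997, §13.1] -/
@[reducible] def layerQuotFintype (n : ℕ) : Fintype (absoluteGaloisGroup K ⧸ κ.layerSubgroup n) :=
  haveI : (κ.layerSubgroup n).FiniteIndex := ⟨by rw [κ.index_layerSubgroup n]; exact pow_ne_zero _ (Fact.out : p.Prime).ne_zero⟩
  Fintype.ofFinite _

/-- **`H^i(res_w, φ) : Lloc_w(n,k) → Lloc_w(n′,k′)`** for a morphism `φ : Maps(Γ_K ⧸ U_n, X_k) ⟶ Maps(Γ_K ⧸ U_{n′}, X_{k′})` of coinduced `Γ_K`-modules (restricted to `Γ_{K_w}`, then `H^i`).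
Every transition of the semilocal tower is of this form. [cite: SerreGaloisCohomology1997, I §2.2] -/
def semilocH {n n' k k' : ℕ}
    (φ : coindFin.{0, 0} (coeffRepK S θ' P k).toTopRep (κ.layerSubgroup n) ⟶ coindFin.{0, 0} (coeffRepK S θ' P k').toTopRep (κ.layerSubgroup n')) (i : ℕ) :
    semilocCoh S κ θ' P w n k i →+ semilocCoh S κ θ' P w n' k' i :=
  (cohomologyMap ((TopRep.resFunctor (resGalOfEmb (closureEmb (K := K) (w.adicCompletion K)) :
    absoluteGaloisGroup (w.adicCompletion K) →* absoluteGaloisGroup K)).map φ) i).hom.toLinearMap.toAddMonoidHom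

/-- Unfolding `semilocH`. [folklore] -/
theorem semilocH_apply {n n' k k' : ℕ}
    (φ : coindFin.{0, 0} (coeffRepK S θ' P k).toTopRep (κ.layerSubgroup n) ⟶ coindFin.{0, 0} (coeffRepK S θ' P k').toTopRep (κ.layerSubgroup n')) (i : ℕ)
    (x : semilocCoh S κ θ' P w n k i) :
    semilocH S κ θ' P w φ i x = (cohomologyMap ((TopRep.resFunctor (resGalOfEmb (closureEmb (K := K) (w.adicCompletion K)) :
      absoluteGaloisGroup (w.adicCompletion K) →* absoluteGaloisGroup K)).map φ) i).hom x :=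
  rfl

/-- `H^i(res_w, φ ≫ ψ) = H^i(res_w, ψ) ∘ H^i(res_w, φ)` (given pointwise). [cite: SerreGaloisCohomology1997, I §2.2] -/
theorem semilocH_comp_apply {n n' n'' k k' k'' : ℕ}
    (φ : coindFin.{0, 0} (coeffRepK S θ' P k).toTopRep (κ.layerSubgroup n) ⟶ coindFin.{0, 0} (coeffRepK S θ' P k').toTopRep (κ.layerSubgroup n'))
    (ψ : coindFin.{0, 0} (coeffRepK S θ' P k').toTopRep (κ.layerSubgroup n') ⟶ coindFin.{0, 0} (coeffRepK S θ' P k'').toTopRep (κ.layerSubgroup n''))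
    (χ : coindFin.{0, 0} (coeffRepK S θ' P k).toTopRep (κ.layerSubgroup n) ⟶ coindFin.{0, 0} (coeffRepK S θ' P k'').toTopRep (κ.layerSubgroup n''))
    (h : ∀ v, χ.hom v = ψ.hom (φ.hom v)) (i : ℕ) (x : semilocCoh S κ θ' P w n k i) :
    semilocH S κ θ' P w χ i x = semilocH S κ θ' P w ψ i (semilocH S κ θ' P w φ i x) := by
  rw [semilocH_apply, semilocH_apply, semilocH_apply]
  exact map_comp_apply_of (ContinuousMonoidHom.id _) (ContinuousMonoidHom.id _) (ContinuousMonoidHom.id _) (fun _ ↦ rfl)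
    (resIdHom ((TopRep.resFunctor (resGalOfEmb (closureEmb (K := K) (w.adicCompletion K)) : absoluteGaloisGroup (w.adicCompletion K) →* absoluteGaloisGroup K)).map φ))
    (resIdHom ((TopRep.resFunctor (resGalOfEmb (closureEmb (K := K) (w.adicCompletion K)) : absoluteGaloisGroup (w.adicCompletion K) →* absoluteGaloisGroup K)).map ψ))
    (resIdHom ((TopRep.resFunctor (resGalOfEmb (closureEmb (K := K) (w.adicCompletion K)) : absoluteGaloisGroup (w.adicCompletion K) →* absoluteGaloisGroup K)).map χ))
    (fun v ↦ h v) i x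

/-- `H^i(res_w, φ) = id` when `φ` is pointwise the identity. [cite: SerreGaloisCohomology1997, I §2.2] -/
theorem semilocH_eq_self {n k : ℕ}
    (φ : coindFin.{0, 0} (coeffRepK S θ' P k).toTopRep (κ.layerSubgroup n) ⟶ coindFin.{0, 0} (coeffRepK S θ' P k).toTopRep (κ.layerSubgroup n))
    (h : ∀ v, φ.hom v = v) (i : ℕ) (x : semilocCoh S κ θ' P w n k i) : semilocH S κ θ' P w φ i x = x := by
  rw [semilocH_apply]
  have e : cohomologyMap ((TopRep.resFunctor (resGalOfEmb (closureEmb (K := K) (w.adicCompletion K)) :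
      absoluteGaloisGroup (w.adicCompletion K) →* absoluteGaloisGroup K)).map φ) i = 𝟙 _ :=
    continuousCohomology_map_eq_id (X := semilocRep S κ θ' P w n k) (ContinuousMonoidHom.id _)
      (resIdHom ((TopRep.resFunctor (resGalOfEmb (closureEmb (K := K) (w.adicCompletion K)) :
        absoluteGaloisGroup (w.adicCompletion K) →* absoluteGaloisGroup K)).map φ)) rfl (fun v ↦ h v) i
  rw [e]
  rfl

/-- `H^i(res_w, φ + ψ) = H^i(res_w, φ) + H^i(res_w, ψ)`. [cite: SerreGaloisCohomology1997, I §2.2] -/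
theorem semilocH_add {n n' k k' : ℕ}
    (φ ψ : coindFin.{0, 0} (coeffRepK S θ' P k).toTopRep (κ.layerSubgroup n) ⟶ coindFin.{0, 0} (coeffRepK S θ' P k').toTopRep (κ.layerSubgroup n')) (i : ℕ) :
    semilocH S κ θ' P w (φ + ψ) i = semilocH S κ θ' P w φ i + semilocH S κ θ' P w ψ i := by
  apply AddMonoidHom.ext
  intro x
  have hres : (TopRep.resFunctor (resGalOfEmb (closureEmb (K := K) (w.adicCompletion K)) : absoluteGaloisGroup (w.adicCompletion K) →* absoluteGaloisGroup K)).map (φ + ψ) =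
      (TopRep.resFunctor (resGalOfEmb (closureEmb (K := K) (w.adicCompletion K)) : absoluteGaloisGroup (w.adicCompletion K) →* absoluteGaloisGroup K)).map φ +
        (TopRep.resFunctor (resGalOfEmb (closureEmb (K := K) (w.adicCompletion K)) : absoluteGaloisGroup (w.adicCompletion K) →* absoluteGaloisGroup K)).map ψ :=
    TopRep.hom_ext (ContIntertwiningMap.ext (ContinuousLinearMap.ext fun _ ↦ rfl))
  have e := continuousCohomology_map_add
    ((TopRep.resFunctor (resGalOfEmb (closureEmb (K := K) (w.adicCompletion K)) : absoluteGaloisGroup (w.adicCompletion K) →* absoluteGaloisGroup K)).map φ)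
    ((TopRep.resFunctor (resGalOfEmb (closureEmb (K := K) (w.adicCompletion K)) : absoluteGaloisGroup (w.adicCompletion K) →* absoluteGaloisGroup K)).map ψ) i
  rw [AddMonoidHom.add_apply, semilocH_apply, semilocH_apply, semilocH_apply, hres]
  exact congrArg (fun m ↦ (TopModuleCat.Hom.hom m) x) e

/-! ## §2. The four transitions -/

/-- **Corestriction `Lloc_w(n+1,k) → Lloc_w(n,k)`** = `H^i(res_w, Σ_{U_{n+1}→U_n})`, the fibre sum of the coinduced coefficients (it sums over the places of `K_{n+1}` above each place of `K_n`
above `w` — Mackey is inside `coindFinSum`). [cite: NeukirchSchmidtWingberg2008, I §5 Prop. (1.5.3)–(1.5.4), I §6 (1.6.4)] [cite: Rubin2000, App. B.3] -/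
def semilocCores (n k i : ℕ) : semilocCoh S κ θ' P w (n + 1) k i →+ semilocCoh S κ θ' P w n k i :=
  letI := layerQuotFintype κ (n + 1)
  semilocH S κ θ' P w (coindFinSum (coeffRepK S θ' P k).toTopRep (κ.layerSubgroup_antitone (Nat.le_succ n))) i

/-- **Change of coefficients `Lloc_w(n,k) → Lloc_w(n,k′)`** along an equivariant `f : X_k → X_{k′}` (`H^i(res_w, Maps(f))`). [cite: Kato2004Asterisque, §8.2 (p. 180)] -/
def semilocCoeff (n : ℕ) {k k' : ℕ} (f : OMuCarrier K S (p ^ k) →+ OMuCarrier K S (p ^ k'))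
    (hf : ∀ (σ : absoluteGaloisGroup K) (x : OMuCarrier K S (p ^ k)), f (muTwistO S θ' k σ x) = muTwistO S θ' k' σ (f x)) (i : ℕ) :
    semilocCoh S κ θ' P w n k i →+ semilocCoh S κ θ' P w n k' i :=
  semilocH S κ θ' P w (coindFinMap (coeffHomK S θ' P f hf) (κ.layerSubgroup n)) i

/-- **Reduction `Lloc_w(n,k+1) → Lloc_w(n,k)`** (`𝒪 ⊗ μ_{p^{k+1}} → 𝒪 ⊗ μ_{p^k}`). [cite: Kato2004Asterisque, §8.2 (p. 180)] -/
def semilocRed (n k i : ℕ) : semilocCoh S κ θ' P w n (k + 1) i →+ semilocCoh S κ θ' P w n k i :=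
  semilocCoeff S κ θ' P w n (oMuRed S k) (oMuRed_muTwistO S θ' k) i

/-- **`𝒪`-scalars on `Lloc_w(n,k)`** (`c ↦ H^i(res_w, Maps(c ⊗ id))`). [cite: JohnsonLeungKings2011, §4.1 Def. 4.1] -/
def semilocScalar (n k i : ℕ) (c : padicCoeffIntegers S) : semilocCoh S κ θ' P w n k i →+ semilocCoh S κ θ' P w n k i :=
  semilocCoeff S κ θ' P w n (oMuScalar S (p ^ k) c) (oMuScalar_muTwistO S θ' k c) i

/-- **Conjugation by `γ ∈ Γ_K` on `Lloc_w(n,k)`** = `H^i(res_w, R_{γ U_n})`, right translation of the coinduced coefficients (T1-a `semilocNK_cycLayerConjO`): the operator through which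
`Λ = ℤ_p⟦Γ⟧` acts. [cite: SerreLocalFields1979, VII §5] [cite: NeukirchSchmidtWingberg2008, I §6 Prop. (1.6.5)] -/
def semilocConj (n k i : ℕ) (γ : absoluteGaloisGroup K) : semilocCoh S κ θ' P w n k i →+ semilocCoh S κ θ' P w n k i :=
  semilocH S κ θ' P w (rTransHom (coeffRepK S θ' P k).toTopRep (κ.layerSubgroup n) (γ : absoluteGaloisGroup K ⧸ κ.layerSubgroup n)) i

/-- T1-a's conjugation law in this currency: `sloc (conj_γ y) = semilocConj γ (sloc y)`. [cite: SerreLocalFields1979, VII §5] -/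
theorem semilocNK_conj (n k : ℕ) (γ : absoluteGaloisGroup K) (y : cycLayerCohO S κ θ' P n k 1) :
    semilocNK S κ θ' P w n k (cycLayerConjO S κ θ' P n k 1 γ y) = semilocConj S κ θ' P w n k 1 γ (semilocNK S κ θ' P w n k y) :=
  semilocNK_cycLayerConjO S κ θ' P w n k γ y

/-- T1-a's reduction law: `sloc (red y) = semilocRed (sloc y)`. [cite: Kato2004Asterisque, §8.2 (p. 180)] -/
theorem semilocNK_red (n k : ℕ) (y : cycLayerCohO S κ θ' P n (k + 1) 1) :
    semilocNK S κ θ' P w n k (cycLayerRedO S κ θ' P n k 1 y) = semilocRed S κ θ' P w n k 1 (semilocNK S κ θ' P w n (k + 1) y) :=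
  semilocNK_cycLayerRedO S κ θ' P w n k y

/-- T1-a's scalar law: `sloc (c • y) = semilocScalar c (sloc y)`. [cite: JohnsonLeungKings2011, §4.1 Def. 4.1] -/
theorem semilocNK_scalar (n k : ℕ) (c : padicCoeffIntegers S) (y : cycLayerCohO S κ θ' P n k 1) :
    semilocNK S κ θ' P w n k (cycLayerScalarO S κ θ' P n k 1 c y) = semilocScalar S κ θ' P w n k 1 c (semilocNK S κ θ' P w n k y) :=
  semilocNK_cycLayerScalarO S κ θ' P w n k c y

/-- T1-a's corestriction law: `sloc (cor y) = semilocCores (sloc y)` (needs `N_P ≤ U_m` for all `m`; the `Fintype` instance is the canonical one). [cite: NeukirchSchmidtWingberg2008, I §5 Prop. 1.5.4] -/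
theorem semilocNK_cores (hNP : ∀ n, ramificationSubgroup K P ≤ κ.layerSubgroup n) (n k : ℕ) (y : cycLayerCohO S κ θ' P (n + 1) k 1) :
    semilocNK S κ θ' P w n k (cycLayerCoresO S κ θ' P n k 1 y) = semilocCores S κ θ' P w n k 1 (semilocNK S κ θ' P w (n + 1) k y) := by
  letI := layerQuotFintype κ n
  letI := layerQuotFintype κ (n + 1)
  haveI : (κ.layerSubgroup (n + 1)).FiniteIndex := ⟨by rw [κ.index_layerSubgroup (n + 1)]; exact pow_ne_zero _ (Fact.out : p.Prime).ne_zero⟩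
  letI : Fintype (↥(κ.layerSubgroup n) ⧸ (κ.layerSubgroup (n + 1)).subgroupOf (κ.layerSubgroup n)) := Fintype.ofFinite _
  exact semilocNK_cycLayerCoresO S κ θ' P w hNP n k y

/-! ## §3. Algebra of the transitions -/

/-- `semilocScalar (c + c′) = semilocScalar c + semilocScalar c′`. [cite: JohnsonLeungKings2011, §4.1 Def. 4.1] -/
theorem semilocScalar_add (n k i : ℕ) (c c' : padicCoeffIntegers S) :
    semilocScalar S κ θ' P w n k i (c + c') = semilocScalar S κ θ' P w n k i c + semilocScalar S κ θ' P w n k i c' := by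
  have h : coindFinMap (coeffHomK S θ' P (oMuScalar S (p ^ k) (c + c')) (oMuScalar_muTwistO S θ' k (c + c'))) (κ.layerSubgroup n) =
      coindFinMap (coeffHomK S θ' P (oMuScalar S (p ^ k) c) (oMuScalar_muTwistO S θ' k c)) (κ.layerSubgroup n) +
        coindFinMap (coeffHomK S θ' P (oMuScalar S (p ^ k) c') (oMuScalar_muTwistO S θ' k c')) (κ.layerSubgroup n) := by
    exact TopRep.hom_ext (ContIntertwiningMap.ext (ContinuousLinearMap.ext fun φ ↦ funext fun y ↦
      Subtype.ext (oMuScalar_add S (p ^ k) c c' ((φ y : (coeffRepK S θ' P k).toTopRep) : OMuCarrier K S (p ^ k)))))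
  unfold semilocScalar semilocCoeff
  rw [h, semilocH_add]

/-- `semilocScalar (c c′) = semilocScalar c ∘ semilocScalar c′`. [cite: JohnsonLeungKings2011, §4.1 Def. 4.1] -/
theorem semilocScalar_mul (n k i : ℕ) (c c' : padicCoeffIntegers S) (x : semilocCoh S κ θ' P w n k i) :
    semilocScalar S κ θ' P w n k i (c * c') x = semilocScalar S κ θ' P w n k i c (semilocScalar S κ θ' P w n k i c' x) :=
  semilocH_comp_apply S κ θ' P w _ _ _ (fun φ ↦ funext fun y ↦
    Subtype.ext (oMuScalar_mul S (p ^ k) c c' ((φ y : (coeffRepK S θ' P k).toTopRep) : OMuCarrier K S (p ^ k)))) i x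

/-- `semilocScalar 1 = id`. [cite: JohnsonLeungKings2011, §4.1 Def. 4.1] -/
theorem semilocScalar_one (n k i : ℕ) (x : semilocCoh S κ θ' P w n k i) : semilocScalar S κ θ' P w n k i 1 x = x :=
  semilocH_eq_self S κ θ' P w _ (fun φ ↦ funext fun y ↦
    Subtype.ext (oMuScalar_one S (p ^ k) ((φ y : (coeffRepK S θ' P k).toTopRep) : OMuCarrier K S (p ^ k)))) i x

/-- **The `𝒪`-action on `Lloc_w(n,k)` as a ring homomorphism `𝒪 → End`.** [cite: JohnsonLeungKings2011, §4.1 Def. 4.1] -/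
def semilocScalarRingHom (n k i : ℕ) : padicCoeffIntegers S →+* AddMonoid.End (semilocCoh S κ θ' P w n k i) where
  toFun c := semilocScalar S κ θ' P w n k i c
  map_one' := AddMonoidHom.ext fun x ↦ semilocScalar_one S κ θ' P w n k i x
  map_mul' c c' := AddMonoidHom.ext fun x ↦ semilocScalar_mul S κ θ' P w n k i c c' x
  map_zero' := by
    have h := semilocScalar_add S κ θ' P w n k i 0 0
    rw [add_zero] at h
    exact left_eq_add.mp h
  map_add' c c' := semilocScalar_add S κ θ' P w n k i c c'

/-- **The `𝒪`-module structure of `Lloc_w(n,k)`** (activate with `letI`). [cite: JohnsonLeungKings2011, §4.1 Def. 4.1] -/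
@[reducible] def semilocModuleO (n k i : ℕ) : Module (padicCoeffIntegers S) (semilocCoh S κ θ' P w n k i) :=
  Module.compHom (semilocCoh S κ θ' P w n k i) (semilocScalarRingHom S κ θ' P w n k i)

/-- The `𝒪`-action is `c • x = semilocScalar c x`. [cite: JohnsonLeungKings2011, §4.1 Def. 4.1] -/
theorem semilocModuleO_smul (n k i : ℕ) (c : padicCoeffIntegers S) (x : semilocCoh S κ θ' P w n k i) :
    (letI := semilocModuleO S κ θ' P w n k i; c • x) = semilocScalar S κ θ' P w n k i c x := rfl

/-- `semilocConj 1 = id`. [cite: SerreLocalFields1979, VII §5] -/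
theorem semilocConj_one (n k i : ℕ) (x : semilocCoh S κ θ' P w n k i) : semilocConj S κ θ' P w n k i 1 x = x :=
  semilocH_eq_self S κ θ' P w _ (fun φ ↦ funext fun y ↦ by rw [rTransHom_apply, QuotientGroup.mk_one, mul_one]) i x

/-- `semilocConj γ ∘ semilocConj γ′ = semilocConj (γ γ′)`. [cite: SerreLocalFields1979, VII §5] -/
theorem semilocConj_semilocConj (n k i : ℕ) (γ γ' : absoluteGaloisGroup K) (x : semilocCoh S κ θ' P w n k i) :
    semilocConj S κ θ' P w n k i γ (semilocConj S κ θ' P w n k i γ' x) = semilocConj S κ θ' P w n k i (γ * γ') x :=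
  (semilocH_comp_apply S κ θ' P w _ _ _ (fun φ ↦ funext fun y ↦ by
    rw [rTransHom_apply, rTransHom_apply, rTransHom_apply, QuotientGroup.mk_mul, mul_assoc]) i x).symm

/-- **Elements of `U_n` act trivially on `Lloc_w(n,k)`** (`R_{γ U_n} = R_{U_n} = id`). [cite: SerreLocalFields1979, VII §5 Prop. 3] -/
theorem semilocConj_eq_self_of_mem (n k i : ℕ) {γ : absoluteGaloisGroup K} (hγ : γ ∈ κ.layerSubgroup n) (x : semilocCoh S κ θ' P w n k i) :
    semilocConj S κ θ' P w n k i γ x = x :=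
  semilocH_eq_self S κ θ' P w _ (fun φ ↦ funext fun y ↦ by rw [rTransHom_apply, (QuotientGroup.eq_one_iff γ).mpr hγ, mul_one]) i x

/-- The conjugation operator as an element of `AddMonoid.End`. [folklore] -/
abbrev semilocConjEnd (n k i : ℕ) (γ : absoluteGaloisGroup K) : AddMonoid.End (semilocCoh S κ θ' P w n k i) :=
  semilocConj S κ θ' P w n k i γ

/-- Powers: `(semilocConj γ)^m = semilocConj (γ^m)`. [cite: SerreLocalFields1979, VII §5] -/
theorem semilocConjEnd_pow_apply (n k i : ℕ) (γ : absoluteGaloisGroup K) (m : ℕ) (x : semilocCoh S κ θ' P w n k i) :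
    (semilocConjEnd S κ θ' P w n k i γ ^ m) x = semilocConj S κ θ' P w n k i (γ ^ m) x := by
  induction m generalizing x with
  | zero => rw [pow_zero, pow_zero, AddMonoid.End.one_apply, semilocConj_one]
  | succ m ih =>
    rw [pow_succ, AddMonoid.End.coe_mul, Function.comp_apply, ih]
    change semilocConj S κ θ' P w n k i (γ ^ m) (semilocConj S κ θ' P w n k i γ x) = _
    rw [semilocConj_semilocConj, ← pow_succ]

/-- **Unipotence of echelon `pⁿ`**: `(semilocConj γ)^{pⁿ} = id` on `Lloc_w(n,k)` (`γ^{pⁿ} ∈ U_n` as `[Γ_K : U_n] = pⁿ`). [cite: Lang1990, Ch. 5 §1] -/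
theorem semilocConjEnd_pow_index_apply (n k i : ℕ) (γ : absoluteGaloisGroup K) (x : semilocCoh S κ θ' P w n k i) :
    (semilocConjEnd S κ θ' P w n k i γ ^ p ^ n) x = x := by
  rw [semilocConjEnd_pow_apply]
  refine semilocConj_eq_self_of_mem S κ θ' P w n k i ?_ x
  rw [← κ.index_layerSubgroup n]
  exact Subgroup.pow_index_mem (κ.layerSubgroup n) γ

/-- **Uniform `p^k`-torsion** of `Lloc_w(n,k)` (the coefficients are killed by `p^k`). [cite: Kato2004Asterisque, §8.2 (p. 180)] [cite: Lang1990, Ch. 5 §1] -/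
theorem semilocCoh_torsion (n k i : ℕ) (x : semilocCoh S κ θ' P w n k i) : p ^ k • x = 0 := by
  haveI : CompactSpace (absoluteGaloisGroup (w.adicCompletion K)) := absoluteGaloisGroup_compactSpace (w.adicCompletion K)
  obtain ⟨m, hm⟩ := continuousCohomology_exists_forall_smul_eq_zero (semilocRep S κ θ' P w n k) (fun _ ↦ Ideal.span {((p ^ k : ℕ) : ℤ)})
    (fun C _ ↦ ⟨0, fun r hr φ _ ↦ by
      obtain ⟨c, rfl⟩ := Ideal.mem_span_singleton'.mp hr
      exact funext fun y ↦ by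
        change (c * ((p ^ k : ℕ) : ℤ)) • φ y = 0
        rw [mul_smul, Nat.cast_pow, coeffGSO_torsion, smul_zero]⟩) i x
  have h := hm ((p ^ k : ℕ) : ℤ) (Ideal.mem_span_singleton_self _)
  rwa [Nat.cast_smul_eq_nsmul] at h

/-- Coefficient maps commute with conjugation: `semilocCoeff f (semilocConj γ x) = semilocConj γ (semilocCoeff f x)`. [cite: SerreLocalFields1979, VII §5] -/
theorem semilocCoeff_semilocConj (n : ℕ) {k k' : ℕ} (f : OMuCarrier K S (p ^ k) →+ OMuCarrier K S (p ^ k'))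
    (hf : ∀ (σ : absoluteGaloisGroup K) (x : OMuCarrier K S (p ^ k)), f (muTwistO S θ' k σ x) = muTwistO S θ' k' σ (f x)) (i : ℕ)
    (γ : absoluteGaloisGroup K) (x : semilocCoh S κ θ' P w n k i) :
    semilocCoeff S κ θ' P w n f hf i (semilocConj S κ θ' P w n k i γ x) = semilocConj S κ θ' P w n k' i γ (semilocCoeff S κ θ' P w n f hf i x) := by
  unfold semilocCoeff semilocConj
  rw [← semilocH_comp_apply S κ θ' P w _ _ (rTransHom (coeffRepK S θ' P k).toTopRep (κ.layerSubgroup n) (γ : absoluteGaloisGroup K ⧸ κ.layerSubgroup n) ≫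
      coindFinMap (coeffHomK S θ' P f hf) (κ.layerSubgroup n)) (fun _ ↦ rfl),
    ← semilocH_comp_apply S κ θ' P w _ _ (rTransHom (coeffRepK S θ' P k).toTopRep (κ.layerSubgroup n) (γ : absoluteGaloisGroup K ⧸ κ.layerSubgroup n) ≫
      coindFinMap (coeffHomK S θ' P f hf) (κ.layerSubgroup n)) (fun _ ↦ rfl)]

/-- `semilocScalar c` commutes with `semilocConj γ`. [cite: JohnsonLeungKings2011, §4.2] -/
theorem semilocScalar_semilocConj (n k i : ℕ) (c : padicCoeffIntegers S) (γ : absoluteGaloisGroup K) (x : semilocCoh S κ θ' P w n k i) :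
    semilocScalar S κ θ' P w n k i c (semilocConj S κ θ' P w n k i γ x) = semilocConj S κ θ' P w n k i γ (semilocScalar S κ θ' P w n k i c x) :=
  semilocCoeff_semilocConj S κ θ' P w n _ _ i γ x

/-- `semilocRed` commutes with `semilocConj γ`. [cite: Kato2004Asterisque, §8.2 (p. 180)] -/
theorem semilocRed_semilocConj (n k i : ℕ) (γ : absoluteGaloisGroup K) (x : semilocCoh S κ θ' P w n (k + 1) i) :
    semilocRed S κ θ' P w n k i (semilocConj S κ θ' P w n (k + 1) i γ x) = semilocConj S κ θ' P w n k i γ (semilocRed S κ θ' P w n k i x) :=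
  semilocCoeff_semilocConj S κ θ' P w n _ _ i γ x

/-- `semilocRed` is `𝒪`-linear: it commutes with `semilocScalar c` (`red ∘ (c ⊗ id) = (c ⊗ id) ∘ red` on the carriers). [cite: Kato2004Asterisque, §8.2 (p. 180)] -/
theorem semilocRed_semilocScalar (n k i : ℕ) (c : padicCoeffIntegers S) (x : semilocCoh S κ θ' P w n (k + 1) i) :
    semilocRed S κ θ' P w n k i (semilocScalar S κ θ' P w n (k + 1) i c x) = semilocScalar S κ θ' P w n k i c (semilocRed S κ θ' P w n k i x) := by
  have hcomm : ∀ v : OMuCarrier K S (p ^ (k + 1)), oMuRed S k (oMuScalar S (p ^ (k + 1)) c v) = oMuScalar S (p ^ k) c (oMuRed S k v) := by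
    intro v
    induction v using OMuCarrier.induction_on with
    | zero => simp
    | tmul a v => rfl
    | add x y hx hy => simp only [map_add, hx, hy]
  unfold semilocRed semilocScalar semilocCoeff
  rw [← semilocH_comp_apply S κ θ' P w _ _ (coindFinMap (coeffHomK S θ' P (oMuScalar S (p ^ (k + 1)) c) (oMuScalar_muTwistO S θ' (k + 1) c)) (κ.layerSubgroup n) ≫
      coindFinMap (coeffHomK S θ' P (oMuRed S k) (oMuRed_muTwistO S θ' k)) (κ.layerSubgroup n)) (fun _ ↦ rfl)]
  exact semilocH_comp_apply S κ θ' P w _ _ _ (fun φ ↦ funext fun y ↦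
    Subtype.ext (hcomm ((φ y : (coeffRepK S θ' P (k + 1)).toTopRep) : OMuCarrier K S (p ^ (k + 1))))) i x

/-- `semilocCores` commutes with `semilocConj γ` (the fibre sum commutes with right translation: `π(z·γU_{n+1}) = π(z)·γU_n`). [cite: NeukirchSchmidtWingberg2008, I §5 Prop. 1.5.4] -/
theorem semilocCores_semilocConj (n k i : ℕ) (γ : absoluteGaloisGroup K) (x : semilocCoh S κ θ' P w (n + 1) k i) :
    semilocCores S κ θ' P w n k i (semilocConj S κ θ' P w (n + 1) k i γ x) = semilocConj S κ θ' P w n k i γ (semilocCores S κ θ' P w n k i x) := by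
  letI := layerQuotFintype κ (n + 1)
  unfold semilocCores semilocConj
  rw [← semilocH_comp_apply S κ θ' P w _ _ (rTransHom (coeffRepK S θ' P k).toTopRep (κ.layerSubgroup (n + 1)) (γ : absoluteGaloisGroup K ⧸ κ.layerSubgroup (n + 1)) ≫
      coindFinSum (coeffRepK S θ' P k).toTopRep (κ.layerSubgroup_antitone (Nat.le_succ n))) (fun _ ↦ rfl)]
  refine semilocH_comp_apply S κ θ' P w _ _ _ (fun ψ ↦ funext fun y ↦ ?_) i x
  change (coindFinSum (coeffRepK S θ' P k).toTopRep (κ.layerSubgroup_antitone (Nat.le_succ n))).hom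
      ((rTransHom (coeffRepK S θ' P k).toTopRep (κ.layerSubgroup (n + 1)) (γ : absoluteGaloisGroup K ⧸ κ.layerSubgroup (n + 1))).hom ψ) y =
    (coindFinSum (coeffRepK S θ' P k).toTopRep (κ.layerSubgroup_antitone (Nat.le_succ n))).hom ψ (y * (γ : absoluteGaloisGroup K ⧸ κ.layerSubgroup n))
  rw [coindFinSum_apply, coindFinSum_apply]
  refine Fintype.sum_equiv (Equiv.mulRight (γ : absoluteGaloisGroup K ⧸ κ.layerSubgroup (n + 1))) _ _ fun z ↦ ?_
  have hπ : Subgroup.quotientMapOfLE (κ.layerSubgroup_antitone (Nat.le_succ n)) (z * (γ : absoluteGaloisGroup K ⧸ κ.layerSubgroup (n + 1))) =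
      Subgroup.quotientMapOfLE (κ.layerSubgroup_antitone (Nat.le_succ n)) z * (γ : absoluteGaloisGroup K ⧸ κ.layerSubgroup n) := by
    induction z using QuotientGroup.induction_on with
    | H a => rfl
  simp only [Equiv.coe_mulRight, rTransHom_apply, hπ, mul_left_inj]

/-- `semilocCores` commutes with every coefficient map (the fibre sum is additive). [cite: NeukirchSchmidtWingberg2008, I §5 Prop. 1.5.2] -/
theorem semilocCores_semilocCoeff (n : ℕ) {k k' : ℕ} (f : OMuCarrier K S (p ^ k) →+ OMuCarrier K S (p ^ k'))
    (hf : ∀ (σ : absoluteGaloisGroup K) (x : OMuCarrier K S (p ^ k)), f (muTwistO S θ' k σ x) = muTwistO S θ' k' σ (f x)) (i : ℕ)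
    (x : semilocCoh S κ θ' P w (n + 1) k i) :
    semilocCores S κ θ' P w n k' i (semilocCoeff S κ θ' P w (n + 1) f hf i x) = semilocCoeff S κ θ' P w n f hf i (semilocCores S κ θ' P w n k i x) := by
  letI := layerQuotFintype κ (n + 1)
  unfold semilocCores semilocCoeff
  rw [← semilocH_comp_apply S κ θ' P w _ _ (coindFinMap (coeffHomK S θ' P f hf) (κ.layerSubgroup (n + 1)) ≫
      coindFinSum (coeffRepK S θ' P k').toTopRep (κ.layerSubgroup_antitone (Nat.le_succ n))) (fun _ ↦ rfl)]
  refine semilocH_comp_apply S κ θ' P w _ _ _ (fun ψ ↦ funext fun y ↦ ?_) i x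
  change (coindFinSum (coeffRepK S θ' P k').toTopRep (κ.layerSubgroup_antitone (Nat.le_succ n))).hom ((coindFinMap (coeffHomK S θ' P f hf) (κ.layerSubgroup (n + 1))).hom ψ) y =
    (coeffHomK S θ' P f hf).hom ((coindFinSum (coeffRepK S θ' P k).toTopRep (κ.layerSubgroup_antitone (Nat.le_succ n))).hom ψ y)
  rw [coindFinSum_apply, coindFinSum_apply, map_sum]
  refine Finset.sum_congr rfl fun z _ ↦ ?_
  split_ifs <;> simp [coindFinMap_apply]

/-- `semilocCores` is `𝒪`-linear. [cite: NeukirchSchmidtWingberg2008, I §5 Prop. 1.5.2] -/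
theorem semilocCores_semilocScalar (n k i : ℕ) (c : padicCoeffIntegers S) (x : semilocCoh S κ θ' P w (n + 1) k i) :
    semilocCores S κ θ' P w n k i (semilocScalar S κ θ' P w (n + 1) k i c x) = semilocScalar S κ θ' P w n k i c (semilocCores S κ θ' P w n k i x) :=
  semilocCores_semilocCoeff S κ θ' P w n _ _ i x

end LevelOps

end Summit.BirchSwinnertonDyer.BirchSwinnertonDyer.Theorems.SmallImageRttD2Seq

end
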